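import Summits.QuantumFields.YangMills.Theorems.UnitScaleTiltHalvingCombTorusTower
import HarnessLib

/-!
# Line H (`BirthV10.stub_halvingStep`, stmt-QuantumFields-19200) — LEMMA B-al-2, brick (B-v) continued: **THE TOWER AT EVERY LEVEL** — the induction invariant of
# ✓`HalvingCombTorusTower.comb_eq_dbar_mul_defect_of_step` EXPORTED with its geometric level factor `(Lʲ)⁴(Lᵏ)⁻⁴` ([Balaban1985Averaging] Prop. 4, (89)∕(127) vs (42)∕(43))

Cell `ym3-torus` (HUMAN RULING D-0037: YM₃ on T³ is ladder rung R3 — NOT d = 4, NOT infinite volume, NOT a mass gap, NOT the Clay problem), width seat `ym3-torus-px3` gen 5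
((B-v) CONCRETE TOWER + COROLLARY pen, ★★OWNER g29 04:11:16Z).  `--supports stmt-QuantumFields-19200 --as helper`; THEOREMS ONLY (0 `def`, 0 `sorry`); count-neutral; nothing
here claims (B-iv), the (b)-row, (M2′), the stub, the crux or the gap.

WHY.  ✓p696214 `comb_eq_dbar_mul_defect_of_step` proves `H_j` with the bound `r_j = 3·80c₁δc²ε₀²·(Lʲ)⁴(Lᵏ)⁻⁴∕L²` for every `j ≤ k` INSIDE its induction but exports only the top
level `j = k`.  Two consumers need the levels below the top with the GEOMETRIC factor (so that sums over `j < k` stay k-uniform): the COROLLARY ★ (the in-block sizes of the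
double-bar fields `D_j`, hence the accumulated frames at the plaquette corners, ✓`Prop8ChartDoubleBarAccFrameSize.norm_accFrames_sub_one_le_of_levelSizes`) and w3-20520 g9's
(B-al-4)₃ (F-h) row (stair sizes of `D_j` on the pyramid).  This file re-runs the same induction with the per-level conclusion (a sibling file, to keep both under 400 lines).

WHAT IS PROVED (namespace `…Theorems.HalvingCombTorusTower`, continued): ★★★ `comb_eq_dbar_mul_defect_levels_of_step` — `∀ j ≤ K − n, ∀ x μ,
‖(dbarIterU j X̂ ⟨π_j x, μ⟩)⁻¹ · avgIter L U′ j x μ − 1‖ ≤ 240·c₁·δc²·ε₀²·(Lʲ)⁴·(Lᵏ)⁻⁴` under EXACTLY the hypotheses of ✓`comb_eq_dbar_mul_defect_of_step` (`hstep` = (B-iv) GLOBAL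
form, `hblk`, the five scalar windows, `InAk` on `univ`); ★★★ `comb_eq_dbar_mul_defect_levels_of_step_inAx` — the same in the B-al-3 door's guard letters (`InAx` via ✓`hblk_of_inAx`).
HONEST SCOPE.  Modulo (B-iv) (displayed `hstep`); NOT a claim about the stub, the crux, the rung or a mass gap.

References: T. Bałaban, CMP **98** (1985) 17–51 [Balaban1985Averaging] ((42)–(43) pp.23–24, Prop. 2 (54) p.26, (89) p.31, (127) p.36, Prop. 4 (134)–(135) pp.38–39);
CMP **109** (1987) 249–301 [Balaban1987RG1] ((0.4) p.253); CMP **99** (1985) 75–102 [Balaban1985RegularSpaces] ((1.7) p.77, (1.19) p.79).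
-/

set_option autoImplicit false

noncomputable section

open scoped BigOperators Matrix.Norms.L2Operator
open NormedSpace

namespace Summit.QuantumFields.YangMills.Theorems.HalvingCombTorusTower

open Literature.MathematicalPhysics.QuantumFieldTheory.Balaban1983to89
open Literature.MathematicalPhysics.QuantumFieldTheory.Balaban1983to89.T3ContinuumYM3Torus
open B7Prop1Explicit renaming Site → LSite
open B7Prop1Explicit (e boxVec axialFn bavg U1)
open B7Prop2Explicit (avgIter avgIter_zero avgIter_succ rescale_apply pdev pdev_nonneg C0 c2' AvgClosed prop2_explicit)
open B7Prop2SpecialUnitary (specialUnitaryUnits)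
open B7Prop4Flat (C2 c4)
open B8Ineq132 (InAk Under)
open B8Eq119TwistedAxial (InAx inAx_iff)
open B8Lemma1NonAbelian (PlaqSmall)
open B10Eq27TorusAxialLog (pull pull_apply transl unitsField toUField)
open Node00 (coverAt coverAt_apply)
open Summit.QuantumFields.YangMills.Theorems.Prop7AxialReprPrint (pull_toUField_mem pdev_pull_lt)
open Summit.QuantumFields.YangMills.Theorems.Prop8ChartDoubleBar (dbarAvgU dbarIterU dbarIterU_zero dbarIterU_succ)

variable (F : T3Family) {n K : ℕ}

/-! ## The per-level statement and its door-letter form -/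

section Levels

open scoped Matrix.Norms.L2Operator

/-- ★★★ **B-al-2 MODULO THE STEP, AT EVERY LEVEL** (v1.1 append): under the hypotheses of `comb_eq_dbar_mul_defect_of_step`, for EVERY `j ≤ k = K − n` and every level-`j`
bond `(x, μ)` of `ℤ³`, `‖(dbarIterU j X̂ ⟨π_j x, μ⟩)⁻¹ · avgIter L U′ j x μ − 1‖ ≤ 240·c₁·δc²·ε₀²·(Lʲ)⁴·(Lᵏ)⁻⁴` — the induction invariant `r_j` of the tower EXPORTED with
its GEOMETRIC level factor (k-uniform sums: `Σ_{j<k} ≤ 240c₁δc²ε₀²∕(L⁴ − 1)`); read by the COROLLARY ★ (in-block sizes of `D_j` ⇒ frames) and by (B-al-4)₃'s (F-h) row.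
Same proof as `comb_eq_dbar_mul_defect_of_step` (whose conclusion is the case `j = k` weakened by `(Lᵏ)⁴(Lᵏ)⁻⁴ = 1`).
[cite: Balaban1985Averaging, (42)-(43) pp.23-24, Prop. 2 (54) p.26, (89) p.31, (127) p.36, Prop. 4 (134)-(135) pp.38-39; Balaban1987RG1, (0.4) p.253] -/
theorem comb_eq_dbar_mul_defect_levels_of_step (hnK : n < K) {ε₀ : ℝ} (hε₀ : 0 < ε₀)
    {A c₁ δc : ℝ} (hc₁ : 0 ≤ c₁) (hδc : 0 ≤ δc)
    -- the STEP (B-iv), global form, at every level with two levels of room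
    (hstep : ∀ (j : ℕ), j + 2 ≤ (F.P K).m + (F.P K).K →
      ∀ (C : LSite (F.P K).d → Fin (F.P K).d → (Matrix (Fin 2) (Fin 2) ℂ)ˣ) (D : GaugeField (F.P K) j (Matrix (Fin 2) (Fin 2) ℂ)ˣ) (ρ p : ℝ),
      0 ≤ ρ → 0 ≤ p →
      (∀ x μ, C x μ ∈ U1 (Matrix (Fin 2) (Fin 2) ℂ)) →
      (∀ (z : LSite (F.P K).d) (r : Fin (F.P K).d → Fin (F.P K).L), axialFn C (((F.P K).L : ℤ) • z) (((F.P K).L : ℤ) • z + boxVec (F.P K).L r) = 1) →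
      (∀ lo hi : LSite (F.P K).d, PlaqSmall C lo hi p) →
      (∀ (x : LSite (F.P K).d) (μ : Fin (F.P K).d), ‖(((D ⟨coverAt (F.P K) j x, μ⟩)⁻¹ * C x μ : (Matrix (Fin 2) (Fin 2) ℂ)ˣ) : Matrix (Fin 2) (Fin 2) ℂ) - 1‖ ≤ ρ) →
      10 ^ 4 * ((((F.P K).d + 2) * (F.P K).L : ℕ) : ℝ) * (δc * p + 2 * ρ) ≤ 1 →
      ((F.P K).L : ℝ) * (2 * (δc * p)) ≤ c4 (F.P K).d →
      ∀ (z : LSite (F.P K).d) (κ : Fin (F.P K).d),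
        ‖(((dbarAvgU D ⟨coverAt (F.P K) (j + 1) z, κ⟩)⁻¹ * bavg (F.P K).L C (((F.P K).L : ℤ) • z) κ : (Matrix (Fin 2) (Fin 2) ℂ)ˣ) :
            Matrix (Fin 2) (Fin 2) ℂ) - 1‖ ≤ (11 / 10) * A * ρ + 5 * c₁ * (((F.P K).L : ℝ) * (δc * p)) ^ 2)
    -- the scalar windows (socket letters)
    (hα3 : C0 (F.P K).d * (2 * ε₀) ≤ 1 / 3) (hα2 : 2 * (2 * ε₀) ≤ c2' (F.P K).d (F.P K).L)
    (hw1 : 10 ^ 4 * ((((F.P K).d + 2) * (F.P K).L : ℕ) : ℝ) * (δc * (4 * ε₀) + 2 * (240 * c₁ * δc ^ 2 * ε₀ ^ 2)) ≤ 1)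
    (hw2 : ((F.P K).L : ℝ) * (2 * (δc * (4 * ε₀))) ≤ c4 (F.P K).d)
    (hA : 33 * A ≤ 20 * ((F.P K).L : ℝ) ^ 4)
    -- the member's field and pre-gauge; socket guards (a) and (b)
    (U : GaugeField (F.P K) 0 (Matrix.specialUnitaryGroup (Fin 2) ℂ)) (gJ : GaugeTransf (F.P K) 0 (Matrix.specialUnitaryGroup (Fin 2) ℂ))
    (hInAk : InAk (F.P K).L (K - n) (((F.L : ℝ)⁻¹) ^ (K - n)) ε₀ (fun _ => (Set.univ : Set (LSite (F.P K).d)))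
      (pull (unitsField (toUField (GaugeField.gaugeAct gJ U))) 0))
    (hblk : ∀ m, m < K - n → ∀ (z : LSite (F.P K).d) (r : Fin (F.P K).d → Fin (F.P K).L),
      axialFn (avgIter (F.P K).L (pull (unitsField (toUField (GaugeField.gaugeAct gJ U))) 0) (K - n - (m + 1))) (((F.P K).L : ℤ) • z)
        (((F.P K).L : ℤ) • z + boxVec (F.P K).L r) = 1) :
    ∀ j, j ≤ K - n → ∀ (x : LSite (F.P K).d) (μ : Fin (F.P K).d),
      ‖(((dbarIterU j (unitsField (toUField (GaugeField.gaugeAct gJ U))) ⟨coverAt (F.P K) j x, μ⟩)⁻¹ *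
            avgIter (F.P K).L (pull (unitsField (toUField (GaugeField.gaugeAct gJ U))) 0) j x μ : (Matrix (Fin 2) (Fin 2) ℂ)ˣ) :
          Matrix (Fin 2) (Fin 2) ℂ) - 1‖ ≤ 240 * c₁ * δc ^ 2 * ε₀ ^ 2 * ((((F.P K).L : ℝ) ^ j) ^ 4 * ((((F.P K).L : ℝ) ^ (K - n))⁻¹) ^ 4) := by
  -- letters
  set X : GaugeField (F.P K) 0 (Matrix (Fin 2) (Fin 2) ℂ)ˣ := unitsField (toUField (GaugeField.gaugeAct gJ U)) with hX
  set U' : LSite (F.P K).d → Fin (F.P K).d → (Matrix (Fin 2) (Fin 2) ℂ)ˣ := pull X 0 with hU'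
  set k : ℕ := K - n with hk
  set Lr : ℝ := ((F.P K).L : ℝ) with hLr
  have hL2 : 2 ≤ (F.P K).L := (F.P K).hL.2
  have hL1 : (1 : ℝ) ≤ Lr := by rw [hLr]; exact_mod_cast (le_trans (by norm_num) hL2)
  have hL0 : (0 : ℝ) < Lr := by linarith
  have hkm : K - n ≤ (F.P K).m + (F.P K).K := by show K - n ≤ F.m + K; omega
  have hroom : ∀ j, j + 1 ≤ k → j + 2 ≤ (F.P K).m + (F.P K).K := by
    intro j hj; show j + 2 ≤ F.m + K; have := F.hm; omega
  -- the fine data: `U′` is `SU(2)`-valued with (52) at threshold `2ε₀L^{−2k}`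
  have hU'G : ∀ w κ, U' w κ ∈ specialUnitaryUnits (Fin 2) := pull_toUField_mem (GaugeField.gaugeAct gJ U) 0
  have hFL : (F.L : ℝ) = Lr := by rw [hLr]; rfl
  have h52 : pdev U' < 2 * ε₀ * ((Lr ^ k)⁻¹) ^ 2 := by
    have h := pdev_pull_lt hε₀ hInAk 0
    rw [hLr]; exact h
  -- the invariant bound
  set T : ℝ := 80 * c₁ * δc ^ 2 * ε₀ ^ 2 with hT
  have hT0 : 0 ≤ T := by positivity
  set r : ℕ → ℝ := fun j => 3 * T * ((Lr ^ j) ^ 4 * ((Lr ^ k)⁻¹) ^ 4) * (Lr ^ 2)⁻¹ with hr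
  have hr0 : ∀ j, 0 ≤ r j := fun j => by positivity
  have hr_le : ∀ j, j ≤ k → r j ≤ 240 * c₁ * δc ^ 2 * ε₀ ^ 2 := by
    intro j hj
    have hq : (Lr ^ j) ^ 4 * ((Lr ^ k)⁻¹) ^ 4 ≤ 1 := by
      rw [← mul_pow, ← div_eq_mul_inv]
      have h1 : Lr ^ j / Lr ^ k ≤ 1 := (div_le_one (pow_pos hL0 k)).mpr (pow_le_pow_right₀ hL1 hj)
      have h0 : 0 ≤ Lr ^ j / Lr ^ k := by positivity
      exact pow_le_one₀ h0 h1
    have hL2inv : (Lr ^ 2)⁻¹ ≤ 1 := inv_le_one_of_one_le₀ (one_le_pow₀ hL1)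
    have h3T : 3 * T = 240 * c₁ * δc ^ 2 * ε₀ ^ 2 := by rw [hT]; ring
    calc r j = 3 * T * (((Lr ^ j) ^ 4 * ((Lr ^ k)⁻¹) ^ 4) * (Lr ^ 2)⁻¹) := by rw [hr]; ring
      _ ≤ 3 * T * (1 * 1) := mul_le_mul_of_nonneg_left (mul_le_mul hq hL2inv (by positivity) zero_le_one) (by positivity)
      _ = 240 * c₁ * δc ^ 2 * ε₀ ^ 2 := by rw [mul_one, mul_one, h3T]
  -- THE INDUCTION: `H_j` with bound `r j` for every `j ≤ k`
  have main : ∀ j, j ≤ k → ∀ (x : LSite (F.P K).d) (μ : Fin (F.P K).d),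
      ‖((((dbarIterU j X) ⟨coverAt (F.P K) j x, μ⟩)⁻¹ * avgIter (F.P K).L U' j x μ : (Matrix (Fin 2) (Fin 2) ℂ)ˣ) : Matrix (Fin 2) (Fin 2) ℂ) - 1‖ ≤ r j := by
    intro j
    induction j with
    | zero =>
      intro _ x μ
      rw [base_level]
      exact hr0 0
    | succ j ih =>
      intro hj1 w κ
      have hjk : j ≤ k := Nat.le_of_succ_le hj1
      have hH := ih hjk
      -- per-level data
      set p : ℝ := 4 * ε₀ * (Lr ^ j) ^ 2 * ((Lr ^ k)⁻¹) ^ 2 with hp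
      have hp0 : 0 ≤ p := by positivity
      have hp4 : p ≤ 4 * ε₀ := p_level_le hL1 hε₀.le hjk
      have hCU : ∀ x μ, avgIter (F.P K).L U' j x μ ∈ U1 (Matrix (Fin 2) (Fin 2) ℂ) :=
        fun x μ => avgIter_mem_U1 U' hU'G hε₀ hα3 hα2 (by rw [← hLr]; exact h52) hjk x μ
      have hCP : ∀ lo hi, PlaqSmall (avgIter (F.P K).L U' j) lo hi p := fun lo hi => by
        have h := plaqSmall_avgIter_level U' hU'G hε₀ hα3 hα2 (k := k) (by rw [← hLr]; exact h52) hjk lo hi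
        rw [hp, hLr]; exact h
      have hCax : ∀ (zz : LSite (F.P K).d) (rr : Fin (F.P K).d → Fin (F.P K).L),
          axialFn (avgIter (F.P K).L U' j) (((F.P K).L : ℤ) • zz) (((F.P K).L : ℤ) • zz + boxVec (F.P K).L rr) = 1 := by
        intro zz rr
        have hm : k - 1 - j < K - n := by omega
        have h := hblk (k - 1 - j) hm zz rr
        have hidx : K - n - (k - 1 - j + 1) = j := by omega
        rw [hidx] at h
        exact h
      -- windows at level `j`
      have hrj := hr_le j hjk
      have hwin1 : 10 ^ 4 * ((((F.P K).d + 2) * (F.P K).L : ℕ) : ℝ) * (δc * p + 2 * r j) ≤ 1 := by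
        have hℓ0 : (0 : ℝ) ≤ 10 ^ 4 * ((((F.P K).d + 2) * (F.P K).L : ℕ) : ℝ) := by positivity
        have hmono : δc * p + 2 * r j ≤ δc * (4 * ε₀) + 2 * (240 * c₁ * δc ^ 2 * ε₀ ^ 2) :=
          add_le_add (mul_le_mul_of_nonneg_left hp4 hδc) (by linarith)
        exact (mul_le_mul_of_nonneg_left hmono hℓ0).trans hw1
      have hwin2 : ((F.P K).L : ℝ) * (2 * (δc * p)) ≤ c4 (F.P K).d := by
        have hL0' : (0 : ℝ) ≤ ((F.P K).L : ℝ) := Nat.cast_nonneg _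
        have hmono : 2 * (δc * p) ≤ 2 * (δc * (4 * ε₀)) := by nlinarith [mul_le_mul_of_nonneg_left hp4 hδc]
        exact (mul_le_mul_of_nonneg_left hmono hL0').trans hw2
      -- THE STEP
      have hS := hstep j (hroom j hj1) (avgIter (F.P K).L U' j) (dbarIterU j X) (r j) p (hr0 j) hp0 hCU hCax hCP hH hwin1 hwin2 w κ
      -- read the two towers at level `j+1`
      rw [dbarIterU_succ, avgIter_succ, rescale_apply]
      refine hS.trans ?_
      -- the scalar budget
      have hb := level_budget (δc := δc) (ε₀ := ε₀) hL1 (by rw [hLr] at hA ⊢; exact hA) hc₁ j k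
      rw [hr]
      simpa only [hLr] using hb
  intro j hj x μ
  refine (main j hj x μ).trans ?_
  -- `r_j = 3T·q_j∕L² ≤ 240c₁δc²ε₀²·q_j`
  have hq0 : 0 ≤ (Lr ^ j) ^ 4 * ((Lr ^ k)⁻¹) ^ 4 := by positivity
  have hL2inv : (Lr ^ 2)⁻¹ ≤ 1 := inv_le_one_of_one_le₀ (one_le_pow₀ hL1)
  have h3T : 3 * T = 240 * c₁ * δc ^ 2 * ε₀ ^ 2 := by rw [hT]; ring
  calc r j = (3 * T * ((Lr ^ j) ^ 4 * ((Lr ^ k)⁻¹) ^ 4)) * (Lr ^ 2)⁻¹ := by rw [hr]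
    _ ≤ (3 * T * ((Lr ^ j) ^ 4 * ((Lr ^ k)⁻¹) ^ 4)) * 1 := mul_le_mul_of_nonneg_left hL2inv (by positivity)
    _ = 240 * c₁ * δc ^ 2 * ε₀ ^ 2 * ((Lr ^ j) ^ 4 * ((Lr ^ k)⁻¹) ^ 4) := by rw [mul_one, h3T]

/-- ★★★ **THE PER-LEVEL STATEMENT IN THE DOOR's GUARD LETTERS** (`InAx` instead of `hblk`, via `hblk_of_inAx`). [cite: Balaban1985Averaging, Prop. 4 (134)-(135) pp.38-39; Balaban1985RegularSpaces, (1.19) p.79] -/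
theorem comb_eq_dbar_mul_defect_levels_of_step_inAx (hnK : n < K) {ε₀ : ℝ} (hε₀ : 0 < ε₀)
    {A c₁ δc : ℝ} (hc₁ : 0 ≤ c₁) (hδc : 0 ≤ δc)
    (hstep : ∀ (j : ℕ), j + 2 ≤ (F.P K).m + (F.P K).K →
      ∀ (C : LSite (F.P K).d → Fin (F.P K).d → (Matrix (Fin 2) (Fin 2) ℂ)ˣ) (D : GaugeField (F.P K) j (Matrix (Fin 2) (Fin 2) ℂ)ˣ) (ρ p : ℝ),
      0 ≤ ρ → 0 ≤ p →
      (∀ x μ, C x μ ∈ U1 (Matrix (Fin 2) (Fin 2) ℂ)) →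
      (∀ (z : LSite (F.P K).d) (r : Fin (F.P K).d → Fin (F.P K).L), axialFn C (((F.P K).L : ℤ) • z) (((F.P K).L : ℤ) • z + boxVec (F.P K).L r) = 1) →
      (∀ lo hi : LSite (F.P K).d, PlaqSmall C lo hi p) →
      (∀ (x : LSite (F.P K).d) (μ : Fin (F.P K).d), ‖(((D ⟨coverAt (F.P K) j x, μ⟩)⁻¹ * C x μ : (Matrix (Fin 2) (Fin 2) ℂ)ˣ) : Matrix (Fin 2) (Fin 2) ℂ) - 1‖ ≤ ρ) →
      10 ^ 4 * ((((F.P K).d + 2) * (F.P K).L : ℕ) : ℝ) * (δc * p + 2 * ρ) ≤ 1 →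
      ((F.P K).L : ℝ) * (2 * (δc * p)) ≤ c4 (F.P K).d →
      ∀ (z : LSite (F.P K).d) (κ : Fin (F.P K).d),
        ‖(((dbarAvgU D ⟨coverAt (F.P K) (j + 1) z, κ⟩)⁻¹ * bavg (F.P K).L C (((F.P K).L : ℤ) • z) κ : (Matrix (Fin 2) (Fin 2) ℂ)ˣ) :
            Matrix (Fin 2) (Fin 2) ℂ) - 1‖ ≤ (11 / 10) * A * ρ + 5 * c₁ * (((F.P K).L : ℝ) * (δc * p)) ^ 2)
    (hα3 : C0 (F.P K).d * (2 * ε₀) ≤ 1 / 3) (hα2 : 2 * (2 * ε₀) ≤ c2' (F.P K).d (F.P K).L)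
    (hw1 : 10 ^ 4 * ((((F.P K).d + 2) * (F.P K).L : ℕ) : ℝ) * (δc * (4 * ε₀) + 2 * (240 * c₁ * δc ^ 2 * ε₀ ^ 2)) ≤ 1)
    (hw2 : ((F.P K).L : ℝ) * (2 * (δc * (4 * ε₀))) ≤ c4 (F.P K).d)
    (hA : 33 * A ≤ 20 * ((F.P K).L : ℝ) ^ 4)
    (U : GaugeField (F.P K) 0 (Matrix.specialUnitaryGroup (Fin 2) ℂ)) (gJ : GaugeTransf (F.P K) 0 (Matrix.specialUnitaryGroup (Fin 2) ℂ))
    (hInAk : InAk (F.P K).L (K - n) (((F.L : ℝ)⁻¹) ^ (K - n)) ε₀ (fun _ => (Set.univ : Set (LSite (F.P K).d)))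
      (pull (unitsField (toUField (GaugeField.gaugeAct gJ U))) 0))
    (hInAx : ∀ m, m ≤ K - n → ∀ Λ : ℕ → Set (LSite (F.P K).d),
      InAx (F.P K).L m Λ (1 : LSite (F.P K).d → Fin (F.P K).d → (Matrix (Fin 2) (Fin 2) ℂ)ˣ) (pull (unitsField (toUField (GaugeField.gaugeAct gJ U))) 0)) :
    ∀ j, j ≤ K - n → ∀ (x : LSite (F.P K).d) (μ : Fin (F.P K).d),
      ‖(((dbarIterU j (unitsField (toUField (GaugeField.gaugeAct gJ U))) ⟨coverAt (F.P K) j x, μ⟩)⁻¹ *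
            avgIter (F.P K).L (pull (unitsField (toUField (GaugeField.gaugeAct gJ U))) 0) j x μ : (Matrix (Fin 2) (Fin 2) ℂ)ˣ) :
          Matrix (Fin 2) (Fin 2) ℂ) - 1‖ ≤ 240 * c₁ * δc ^ 2 * ε₀ ^ 2 * ((((F.P K).L : ℝ) ^ j) ^ 4 * ((((F.P K).L : ℝ) ^ (K - n))⁻¹) ^ 4) :=
  comb_eq_dbar_mul_defect_levels_of_step F hnK hε₀ hc₁ hδc hstep hα3 hα2 hw1 hw2 hA U gJ hInAk (hblk_of_inAx _ hInAx)

end Levels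

end Summit.QuantumFields.YangMills.Theorems.HalvingCombTorusTower

end
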